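import Summits.CriticalPhenomena.PercolationContinuityZ3.Theorems.PercNearOneGluingNoHeavyLowerTailSelectionLevelOneTools
import Summits.CriticalPhenomena.PercolationContinuityZ3.Theorems.PercNearOneGluingNoHeavyLowerTailAveragedPostFKG
import Summits.CriticalPhenomena.PercolationContinuityZ3.Theorems.PercNearOneGluingNoHeavyLowerTailBlockSeparation
import Summits.CriticalPhenomena.PercolationContinuityZ3.Theorems.PercNearOneGluingNoHeavyLowerTailRankedSelection
import HarnessLib

/-!
# `NoHeavyLowerTail` (stmt-CriticalPhenomena-4575) — the selection inequality (SO_ρ) at LEVEL `j = 1` for EVERY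
# relay set (a k-uniform bottom rung), and (SO_ρ) for `|A| = 3` at every level

Hull-port prover #4 (prim-hp-4 gen 7, LP-duality line), 2026-08-19.  `μ = prodBernoulli w` on `Fin n`; relays `A`,
observer `o`, avoided relay `a₁ ∈ A`, `S = A ∖ a₁`; for `b ∈ S`: `D_b = {b ↮ A ∖ b}` (at level `1` this IS the
light-and-avoid event `F_b = {b ↮ a₁, M_b ≤ 1}`), `q_b = μ(D_b)`; for a ranking `ρ` the first-reached events
`E_b = {o ↔ b} ∩ {o ↮ c for every c ∈ S ranked before b}`, `W` = the `ρ`-first relay of `S` joined to `o`.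
**`selectionOrder_levelOne`.**  If `ρ` ranks MORE ISOLATED relays first then `Σ_b μ(E_b ∩ D_b) ≤ Σ_b μ(E_b)·q_b`:
  `Σ_{b ∈ S} μ(C(o) ∩ A = {b}) ≤ E[ q_W ; o ↔ S ] = E[ max_{b ∈ C(o) ∩ S} q_b ]`,
sharpening Kozma–Nitzan's Lemma 2 for singleton blocks (`≤ max_b q_b`, tree `Theorems.disjointClusters_sum_le`): the
maximal isolation probability is replaced by that of the loneliest relay `o` ACTUALLY reaches.  PROOF (condition on
total separation, then Harris): with `M = ⋂_b D_b`, block terminal separation (KN Lemma 1(i), tree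
`Theorems.blockTerminalSeparation`) gives `μ(o↔b, D_b)·μ(M) ≤ q_b·μ(o↔b, M)`; on `M`, `{o↔b} ∩ M = E_b ∩ M`, and
`Σ_b q_b 1_{E_b} = q_W 1{o↔S}` is INCREASING (ranking by decreasing `q`), so Harris against the decreasing `M` gives
`Σ_b q_b μ(E_b ∩ M) ≤ μ(M) Σ_b q_b μ(E_b)` (Abel-summation induction `abelHarris_first`, file `…SelectionLevelOneTools`); divide by
`μ(M) ≥ Π_b q_b > 0` (relays with `q_b = 0` are ranked last and contribute `0`).  COROLLARIES: the hypothesis of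
`SelectionOrder.noHeavyLowerTail_of_selectionOrder` holds at level `1` in every instance
(`selectionOrder_hypothesis_levelOne`); with `selectionOrder_three` (gen 5) the selection inequality is a theorem
for `|A| = 3` at EVERY level (`selectionOrder_card_three`).  No definitions, no sorries, standard axioms.
-/

noncomputable section

namespace Summit.CriticalPhenomena.PercolationContinuityZ3.Theorems

open MeasureTheory Set Literature.Probability.LatticeModels Literature.Probability.Percolation
open scoped Classical BigOperators

namespace SelectionOrder

variable {n : ℕ}

/-- **The selection inequality (SO_ρ) at level `j = 1`, for every relay set.**  For `a₁ ∈ A` and a ranking `ρ`,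
injective on `A ∖ a₁`, that lists MORE ISOLATED relays first (`ρ c < ρ b ⇒ q_b ≤ q_c`, `q_b = μ(b ↮ A ∖ b)`):
`Σ_{b ∈ A∖a₁} μ(E_b ∩ F_b) ≤ Σ_{b ∈ A∖a₁} μ(E_b)·μ(F_b)` at `j = 1`, where `E_b = {o ↔ b} ∩ {o ↮ c, ρ c < ρ b}` and
`F_b = {b ↮ a₁, M_b ≤ 1}` (`= {b ↮ A∖b}`).  Equivalently `Σ_b μ(C(o) ∩ A = {b}) ≤ E[q_W ; o ↔ A∖a₁]`, `W` the first
reached relay — a sharpening of Kozma–Nitzan's Lemma 2 for singletons.  Proof: block terminal separation on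
`M = {all relays pairwise separated}`, `{o↔b} ∩ M = E_b ∩ M`, and the Abel–Harris step; relays with `q_b = 0` are
discarded first (they are ranked last and contribute `0`).
[cite: KozmaNitzan2024, Lemma 1(i), Lemma 2 (pp. 5–6); VandenbergHaggstromKahn2005, Thm. 1.3; this work] -/
theorem selectionOrder_levelOne (w : Sym2 (Fin n) → unitInterval) (A : Finset (Fin n)) (o a₁ : Fin n)
    (ha₁ : a₁ ∈ A) (ρ : Fin n → ℕ) (hρ : Set.InjOn ρ ↑(A.erase a₁))
    (hq : ∀ b ∈ A.erase a₁, ∀ c ∈ A.erase a₁, ρ c < ρ b →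
      (prodBernoulli w).real {ω : BondConfig (Fin n) | ∀ a ∈ A \ {b}, ω ∉ openConn b a} ≤
        (prodBernoulli w).real {ω : BondConfig (Fin n) | ∀ a ∈ A \ {c}, ω ∉ openConn c a}) :
    ∑ b ∈ A.erase a₁, (prodBernoulli w).real
        ((openConn o b ∩ {ω : BondConfig (Fin n) | ∀ c ∈ A.erase a₁, ρ c < ρ b → ω ∉ openConn o c}) ∩
          {ω : BondConfig (Fin n) | ω ∉ openConn b a₁ ∧ (A.filter fun x => ω ∈ openConn b x).card ≤ 1}) ≤
      ∑ b ∈ A.erase a₁, (prodBernoulli w).real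
          (openConn o b ∩ {ω : BondConfig (Fin n) | ∀ c ∈ A.erase a₁, ρ c < ρ b → ω ∉ openConn o c}) *
        (prodBernoulli w).real
          {ω : BondConfig (Fin n) | ω ∉ openConn b a₁ ∧ (A.filter fun x => ω ∈ openConn b x).card ≤ 1} := by
  set μ := prodBernoulli w with hμ
  set S := A.erase a₁ with hS
  -- isolation events and probabilities
  set D : Fin n → Set (BondConfig (Fin n)) := fun b => {ω | ∀ a ∈ A \ {b}, ω ∉ openConn b a} with hD
  set q : Fin n → ℝ := fun b => μ.real (D b) with hqdef
  have hq0 : ∀ b, 0 ≤ q b := fun b => measureReal_nonneg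
  -- rewrite `F_b` as `D_b`
  have hF : ∀ b ∈ S, {ω : BondConfig (Fin n) | ω ∉ openConn b a₁ ∧ (A.filter fun x => ω ∈ openConn b x).card ≤ 1} = D b :=
    fun b hb => avoidLight_one_eq_isolated A a₁ b ha₁ hb
  -- first-reached events relative to a sub-family `T`
  set E : Finset (Fin n) → Fin n → Set (BondConfig (Fin n)) := fun T b =>
    openConn o b ∩ {ω : BondConfig (Fin n) | ∀ c ∈ T, ρ c < ρ b → ω ∉ openConn o c} with hE
  have hL : ∑ b ∈ S, μ.real (E S b ∩
      {ω : BondConfig (Fin n) | ω ∉ openConn b a₁ ∧ (A.filter fun x => ω ∈ openConn b x).card ≤ 1}) =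
        ∑ b ∈ S, μ.real (E S b ∩ D b) :=
    Finset.sum_congr rfl fun b hb => by rw [hF b hb]
  have hR : ∑ b ∈ S, μ.real (E S b) *
      μ.real {ω : BondConfig (Fin n) | ω ∉ openConn b a₁ ∧ (A.filter fun x => ω ∈ openConn b x).card ≤ 1} =
        ∑ b ∈ S, μ.real (E S b) * q b :=
    Finset.sum_congr rfl fun b hb => by rw [hF b hb]
  change ∑ b ∈ S, μ.real (E S b ∩
      {ω : BondConfig (Fin n) | ω ∉ openConn b a₁ ∧ (A.filter fun x => ω ∈ openConn b x).card ≤ 1}) ≤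
    ∑ b ∈ S, μ.real (E S b) *
      μ.real {ω : BondConfig (Fin n) | ω ∉ openConn b a₁ ∧ (A.filter fun x => ω ∈ openConn b x).card ≤ 1}
  rw [hL, hR]
  -- the relays with positive isolation probability; the others are ranked after them
  set B := S.filter fun b => 0 < q b with hB
  have hBS : B ⊆ S := Finset.filter_subset _ _
  have hBA : ∀ b ∈ B, b ∈ A := fun b hb => Finset.mem_of_mem_erase (hBS hb)
  have hqz : ∀ b ∈ S, b ∉ B → q b = 0 := by
    intro b hb hbB
    have : ¬ 0 < q b := fun h => hbB (Finset.mem_filter.2 ⟨hb, h⟩)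
    exact le_antisymm (not_lt.1 this) (hq0 b)
  have hEB : ∀ b ∈ B, E S b = E B b := by
    intro b hb
    obtain ⟨hbS, hbpos⟩ := Finset.mem_filter.1 hb
    ext ω
    simp only [hE, mem_inter_iff, mem_setOf_eq]
    constructor
    · rintro ⟨hob, h⟩
      exact ⟨hob, fun c hc hlt => h c (hBS hc) hlt⟩
    · rintro ⟨hob, h⟩
      refine ⟨hob, fun c hc hlt => ?_⟩
      by_cases hcB : c ∈ B
      · exact h c hcB hlt
      · -- `c` has `q c = 0 < q b`, contradicting the ranking
        have h1 : q b ≤ q c := hq b hbS c hc hlt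
        rw [hqz c hc hcB] at h1
        exact absurd hbpos (not_lt.2 h1)
  -- reduce both sums to `B`
  have hLHS : ∑ b ∈ S, μ.real (E S b ∩ D b) ≤ ∑ b ∈ B, μ.real (E B b ∩ D b) := by
    rw [← Finset.sum_filter_add_sum_filter_not S fun b => 0 < q b]
    have h1 : ∑ b ∈ S.filter (fun b => ¬ 0 < q b), μ.real (E S b ∩ D b) ≤ 0 := by
      refine Finset.sum_nonpos fun b hb => ?_
      obtain ⟨hbS, hbn⟩ := Finset.mem_filter.1 hb
      have hbB : b ∉ B := fun h => hbn (Finset.mem_filter.1 h).2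
      calc μ.real (E S b ∩ D b) ≤ μ.real (D b) := measureReal_mono inter_subset_right
        _ = q b := rfl
        _ = 0 := hqz b hbS hbB
        _ ≤ 0 := le_rfl
    have h2 : ∑ b ∈ S.filter (fun b => 0 < q b), μ.real (E S b ∩ D b) = ∑ b ∈ B, μ.real (E B b ∩ D b) :=
      Finset.sum_congr rfl fun b hb => by rw [hEB b hb]
    linarith
  have hRHS : ∑ b ∈ B, μ.real (E B b) * q b ≤ ∑ b ∈ S, μ.real (E S b) * q b := by
    calc ∑ b ∈ B, μ.real (E B b) * q b = ∑ b ∈ B, μ.real (E S b) * q b :=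
          Finset.sum_congr rfl fun b hb => by rw [hEB b hb]
      _ ≤ ∑ b ∈ S, μ.real (E S b) * q b :=
          Finset.sum_le_sum_of_subset_of_nonneg hBS fun b _ _ => mul_nonneg measureReal_nonneg (hq0 b)
  refine le_trans hLHS (le_trans ?_ hRHS)
  -- the core on `B`: condition on total separation `M`
  set M : Set (BondConfig (Fin n)) := {ω | ∀ b ∈ B, ∀ a ∈ A \ {b}, ω ∉ openConn b a} with hMdef
  have hMlow : IsLowerSet M := by
    intro ω ω' hle hω b hb a ha h
    exact hω b hb a ha (isUpperSet_openConn b a hle h)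
  -- `μ(M) > 0`
  have hMpos : 0 < μ.real M := by
    have hM_eq : M = ⋂ b ∈ B, D b := by
      ext ω
      simp only [hMdef, hD, mem_setOf_eq, mem_iInter]
    have hprod : ∏ b ∈ B, q b ≤ μ.real M := by
      rw [hM_eq]
      exact prodBernoulli_prod_le_real_iInter_of_isLowerSet w B
        (fun b _ => fun ω ω' hle hω a ha h => hω a ha (isUpperSet_openConn b a hle h))
        (fun b _ => MeasurableSet.of_discrete)
    exact lt_of_lt_of_le (Finset.prod_pos fun b hb => (Finset.mem_filter.1 hb).2) hprod
  -- termwise block terminal separation: `μ(o↔b, D_b) μ(M) ≤ q_b μ(o↔b, M)`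
  have hterm : ∀ b ∈ B, μ.real (E B b ∩ D b) * μ.real M ≤ q b * μ.real (E B b ∩ M) := by
    intro b hb
    have hbA' : b ∈ A := hBA b hb
    set P : Finset (Fin n × Fin n) := ((B.erase b) ×ˢ A).filter fun p => p.1 ≠ p.2 with hP
    have hP1 : ∀ p ∈ P, p.1 ∈ A \ {b} := by
      intro p hp
      obtain ⟨hp', _⟩ := Finset.mem_filter.1 hp
      obtain ⟨h1, _⟩ := Finset.mem_product.1 hp'
      obtain ⟨h1b, h1B⟩ := Finset.mem_erase.1 h1
      exact Finset.mem_sdiff.2 ⟨hBA _ h1B, by rwa [Finset.mem_singleton]⟩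
    have key := blockTerminalSeparation w {b} (A \ {b}) o P hP1
    -- identify the four events
    have e1 : {ω : BondConfig (Fin n) | ∃ b' ∈ ({b} : Finset (Fin n)), ω ∈ openConn o b'} = openConn o b := by
      ext ω; simp
    have e2 : {ω : BondConfig (Fin n) | ∀ b' ∈ ({b} : Finset (Fin n)), ∀ t ∈ A \ {b}, ω ∉ openConn b' t} = D b := by
      ext ω; simp [hD]
    have e3 : D b ∩ {ω : BondConfig (Fin n) | ∀ p ∈ P, ω ∉ openConn p.1 p.2} = M := by
      ext ω
      simp only [mem_inter_iff, mem_setOf_eq, hD, hMdef, hP, Finset.mem_filter, Finset.mem_product,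
        Finset.mem_erase, and_imp, Prod.forall]
      constructor
      · rintro ⟨hDb, hQ⟩ c hc a ha
        by_cases hcb : c = b
        · subst hcb; exact hDb a ha
        · obtain ⟨haA, hac⟩ := Finset.mem_sdiff.1 ha
          rw [Finset.mem_singleton] at hac
          exact hQ c a hcb hc haA (Ne.symm hac)
      · intro h
        refine ⟨h b hb, fun c a hcb hcB haA hca => h c hcB a (Finset.mem_sdiff.2 ⟨haA, ?_⟩)⟩
        rw [Finset.mem_singleton]; exact Ne.symm hca
    rw [e1, e2, e3] at key
    -- `{o↔b} ∩ M = E_b ∩ M` and `E_b ∩ D_b ⊆ {o↔b} ∩ D_b`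
    have e4 : openConn o b ∩ M = E B b ∩ M := by
      ext ω
      simp only [mem_inter_iff, hE, mem_setOf_eq]
      constructor
      · rintro ⟨hob, hM⟩
        refine ⟨⟨hob, fun c hc hlt hoc => ?_⟩, hM⟩
        have hcb : c ≠ b := fun h => by subst h; exact lt_irrefl _ hlt
        have hbc : (openGraph ω).Reachable b c := (hob : (openGraph ω).Reachable o b).symm.trans hoc
        exact hM b hb c (Finset.mem_sdiff.2 ⟨hBA c hc, by rwa [Finset.mem_singleton]⟩) hbc
      · rintro ⟨⟨hob, _⟩, hM⟩
        exact ⟨hob, hM⟩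
    have hsub : E B b ∩ D b ⊆ openConn o b ∩ D b := inter_subset_inter_left _ inter_subset_left
    calc μ.real (E B b ∩ D b) * μ.real M ≤ μ.real (openConn o b ∩ D b) * μ.real M :=
          mul_le_mul_of_nonneg_right (measureReal_mono hsub) measureReal_nonneg
      _ ≤ μ.real (D b) * μ.real (openConn o b ∩ M) := key
      _ = q b * μ.real (E B b ∩ M) := by rw [e4]
  -- the Abel–Harris step on `B` with threshold `t = 0`
  have hρB : Set.InjOn ρ ↑B := fun x hx y hy hxy =>
    hρ (Finset.mem_coe.2 (hBS (Finset.mem_coe.1 hx))) (Finset.mem_coe.2 (hBS (Finset.mem_coe.1 hy))) hxy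
  have hqB : ∀ b ∈ B, ∀ c ∈ B, ρ c < ρ b → q b ≤ q c := fun b hb c hc h => hq b (hBS hb) c (hBS hc) h
  have hAH := abelHarris_first w B o ρ hρB q hqB 0 (fun b _ => hq0 b) M hMlow
  simp only [zero_mul, add_zero] at hAH
  -- assemble: `μ(M) Σ μ(E_b ∩ D_b) ≤ Σ q_b μ(E_b ∩ M) ≤ μ(M) Σ q_b μ(E_b)`
  have h1 : (∑ b ∈ B, μ.real (E B b ∩ D b)) * μ.real M ≤ ∑ b ∈ B, q b * μ.real (E B b ∩ M) := by
    rw [Finset.sum_mul]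
    exact Finset.sum_le_sum hterm
  have h2 : ∑ b ∈ B, q b * μ.real (E B b ∩ M) ≤ μ.real M * ∑ b ∈ B, q b * μ.real (E B b) := hAH
  have h3 : (∑ b ∈ B, μ.real (E B b ∩ D b)) * μ.real M ≤ (∑ b ∈ B, μ.real (E B b) * q b) * μ.real M := by
    calc (∑ b ∈ B, μ.real (E B b ∩ D b)) * μ.real M ≤ μ.real M * ∑ b ∈ B, q b * μ.real (E B b) := h1.trans h2
      _ = (∑ b ∈ B, μ.real (E B b) * q b) * μ.real M := by
          rw [mul_comm]
          congr 1
          exact Finset.sum_congr rfl fun b _ => mul_comm _ _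
  exact le_of_mul_le_mul_right h3 hMpos

/-- **(SO_ρ) at level `1` holds in every instance** (the hypothesis of `noHeavyLowerTail_of_selectionOrder` for
`j = 1`): for every `a₁ ∈ A` there is a ranking, injective on `A ∖ a₁`, with the level-`1` selection
inequality — rank by decreasing isolation probability `μ(b ↮ A ∖ b)`. [this work] -/
theorem selectionOrder_levelOne_exists (w : Sym2 (Fin n) → unitInterval) (A : Finset (Fin n)) (o a₁ : Fin n)
    (ha₁ : a₁ ∈ A) :
    ∃ ρ : Fin n → ℕ, Set.InjOn ρ ↑(A.erase a₁) ∧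
      ∑ b ∈ A.erase a₁, (prodBernoulli w).real
          ((openConn o b ∩ {ω : BondConfig (Fin n) | ∀ c ∈ A.erase a₁, ρ c < ρ b → ω ∉ openConn o c}) ∩
            {ω : BondConfig (Fin n) | ω ∉ openConn b a₁ ∧ (A.filter fun x => ω ∈ openConn b x).card ≤ 1}) ≤
        ∑ b ∈ A.erase a₁, (prodBernoulli w).real
            (openConn o b ∩ {ω : BondConfig (Fin n) | ∀ c ∈ A.erase a₁, ρ c < ρ b → ω ∉ openConn o c}) *
          (prodBernoulli w).real
            {ω : BondConfig (Fin n) | ω ∉ openConn b a₁ ∧ (A.filter fun x => ω ∈ openConn b x).card ≤ 1} := by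
  obtain ⟨ρ, hρ, hmono⟩ := CoinReduction.exists_compatible_ranking
    (fun b => (prodBernoulli w).real {ω : BondConfig (Fin n) | ∀ a ∈ A \ {b}, ω ∉ openConn b a}) (A.erase a₁)
  exact ⟨ρ, hρ, selectionOrder_levelOne w A o a₁ ha₁ ρ hρ fun b hb c hc h => hmono c hc b hb h⟩


/-- **The hypothesis of `noHeavyLowerTail_of_selectionOrder` at level `j = 1`, for every instance** (`|A| ≥ 2`,
any `o`): some `a₁ ∈ A` (indeed every) and some ranking satisfy the level-`1` selection inequality. [this work] -/
theorem selectionOrder_hypothesis_levelOne (w : Sym2 (Fin n) → unitInterval) (A : Finset (Fin n)) (o : Fin n)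
    (h2 : 2 ≤ A.card) :
    ∃ a₁ ∈ A, ∃ ρ : Fin n → ℕ, Set.InjOn ρ ↑(A.erase a₁) ∧
      ∑ b ∈ A.erase a₁, (prodBernoulli w).real
          ((openConn o b ∩ {ω : BondConfig (Fin n) | ∀ c ∈ A.erase a₁, ρ c < ρ b → ω ∉ openConn o c}) ∩
            {ω : BondConfig (Fin n) | ω ∉ openConn b a₁ ∧ (A.filter fun x => ω ∈ openConn b x).card ≤ 1}) ≤
        ∑ b ∈ A.erase a₁, (prodBernoulli w).real
            (openConn o b ∩ {ω : BondConfig (Fin n) | ∀ c ∈ A.erase a₁, ρ c < ρ b → ω ∉ openConn o c}) *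
          (prodBernoulli w).real
            {ω : BondConfig (Fin n) | ω ∉ openConn b a₁ ∧ (A.filter fun x => ω ∈ openConn b x).card ≤ 1} := by
  have hne : A.Nonempty := Finset.card_pos.1 (by omega)
  obtain ⟨a₁, ha₁⟩ := hne
  exact ⟨a₁, ha₁, selectionOrder_levelOne_exists w A o a₁ ha₁⟩

/-- **(SO_ρ) is a theorem for `|A| = 3` at EVERY level `j ≥ 1`**: for `a₁ ∈ A` some ranking of the two relays of
`A ∖ a₁` satisfies the selection inequality — at `j = 1` rank by isolation (`selectionOrder_levelOne`), at `j ≥ 2`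
rank the relay less reliable to `a₁` first (`selectionOrder_three`, the averaged post-FKG inequality). [this work] -/
theorem selectionOrder_card_three (w : Sym2 (Fin n) → unitInterval) (A : Finset (Fin n)) (o a₁ : Fin n)
    (j : ℕ) (ha₁ : a₁ ∈ A) (h3 : A.card = 3) (hj : 1 ≤ j) :
    ∃ ρ : Fin n → ℕ, Set.InjOn ρ ↑(A.erase a₁) ∧
      ∑ b ∈ A.erase a₁, (prodBernoulli w).real
          ((openConn o b ∩ {ω : BondConfig (Fin n) | ∀ c ∈ A.erase a₁, ρ c < ρ b → ω ∉ openConn o c}) ∩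
            {ω : BondConfig (Fin n) | ω ∉ openConn b a₁ ∧ (A.filter fun x => ω ∈ openConn b x).card ≤ j}) ≤
        ∑ b ∈ A.erase a₁, (prodBernoulli w).real
            (openConn o b ∩ {ω : BondConfig (Fin n) | ∀ c ∈ A.erase a₁, ρ c < ρ b → ω ∉ openConn o c}) *
          (prodBernoulli w).real
            {ω : BondConfig (Fin n) | ω ∉ openConn b a₁ ∧ (A.filter fun x => ω ∈ openConn b x).card ≤ j} := by
  by_cases hj1 : j = 1
  · subst hj1
    exact selectionOrder_levelOne_exists w A o a₁ ha₁
  have hj2 : 2 ≤ j := by omega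
  have hcard : (A.erase a₁).card = 2 := by rw [Finset.card_erase_of_mem ha₁, h3]
  obtain ⟨x, y, hxy, hxy'⟩ := Finset.card_eq_two.1 hcard
  rcases le_total ((prodBernoulli w).real (openConn x a₁)) ((prodBernoulli w).real (openConn y a₁)) with hle | hle
  · obtain ⟨ρ, hinj, hρ⟩ := exists_ranking_pair (A.erase a₁) x y hxy hxy'
    exact ⟨ρ, hinj, selectionOrder_three w A o a₁ x y j hxy' hxy hj2 ρ hρ hle⟩
  · have hyx' : A.erase a₁ = {y, x} := by rw [hxy', Finset.pair_comm]
    obtain ⟨ρ, hinj, hρ⟩ := exists_ranking_pair (A.erase a₁) y x hxy.symm hyx'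
    exact ⟨ρ, hinj, selectionOrder_three w A o a₁ y x j hyx' hxy.symm hj2 ρ hρ hle⟩

end SelectionOrder

end Summit.CriticalPhenomena.PercolationContinuityZ3.Theorems

end
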